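import Mathlib
import Literature.Computability.AlgebraicComplexity.GroupTheoreticMatMul
import Literature.Barriers.MatrixMultiplication.TricoloredSumFreeBarrier
import Summits.MatrixMultiplication.MatrixMultiplication.Theorems.GroupTheoreticSTPPCThesisPackingSumset

/-!
# The iterated room lemma: U14 slack bounds the growth of the iterated difference sets of every block (cell mm-stpp, theory g8)

A STRUCTURAL necessary condition for census-STPP families (`IsSTPP`, CKSU 2005 Def. 5.1) in a finite abelian group `G`, `|G| = n`,
beyond member/pair sumset CARDINALITIES (KILL-MEMO §9 R-5 Q-ii asks for exactly such a condition).  Fix a member `t` with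
`V = |A_t||B_t||C_t|` and let `s` bound its U14 slack: `n ≤ V + Σ_{u ≠ t} |A_u||B_u| + s`.  The tree's set-level U14⁺
(`STPPPackingSumset.sum_card_mul_add_card_sumset_le`: `Σ_{u≠t}|A_u||B_u| + |(A_t − B_t) + (C_t − C_t)| ≤ n`) says that the `V`-set
`W = A_t − B_t + C_t` (all sums distinct by the TPP) has `|W − C_t| ≤ V + s`; two translates `W − c`, `W − c'` of `W` inside that set
overlap in `≥ V − s` points, i.e. **every difference `d ∈ C_t − C_t` is a `(V − s)`-popular difference of `W`**:
`|W ∩ (W + d)| ≥ V − s` (mm-stpp-eng-1, QI-FOURIER-NOTE §1 (i), 2026-08-26, pencil).  This file proves that and ITERATES it: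
* `overlap_add` — popular differences compose: `|W ∩ (W + d)| + |W ∩ (W + d')| ≤ |W| + |W ∩ (W + (d + d'))|`;
* `overlap_nsmul` — hence every `d` in the `k`-fold sumset `k • D` of a set `D` of `(V − s)`-popular differences is `(V − ks)`-popular;
* `card_mul_le_card_sq` — a set of `θ`-popular differences of `W` has at most `|W|²/θ` elements (double counting);
* `card_nsmul_sub_sub_mul_le` — **for an `IsSTPP` family: `|k • (C_t − C_t)| · (V − k s) ≤ V²` for every `k`**, and the two
  rotations (`A_t − A_t` with the `Σ|B_u||C_u|`-slack, `B_t − B_t` with the `Σ|C_u||A_u|`-slack) via `IsSTPP.rotate`.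
So a block of a near-tight STPP family has SLOWLY GROWING iterated difference sets — an additive-structure constraint on each single
set `A_t`, `B_t`, `C_t` that no rule of the cell's sieve (vM/vN/vP: lower bounds on sumset cardinalities of members and pairs plus
packing) expresses.  Numbers on the alive lists of the census (seat note HOME/mm-stpp-theory/QII-ITERATED-ROOM.md): at order 338, a
`(6,6,6)` member of `(7,5,5)+(6,6,6)³` has `s = 15`, so `|2(C−C)| ≤ 250` and `|5(C−C)| ≤ 330 < 338` — satisfied by 3.5 % of random
6-subsets of `ℤ/338`; at the prime 521 a `(7,7,7)` member of `(7,7,7)⁴+(3,1,1)` has `s = 28`, `|2(C−C)| ≤ 409`, `|4(C−C)| ≤ 509 < 521`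
— satisfied by 1 % of random 7-subsets.
WHAT THIS IS NOT: no exclusion of any alive list, no census row, no `ω` statement; a necessary condition (search-space reduction and
the seed of a structure-vs-independence argument), kernel-checked.
-/

-- single-conjunct summit: the mandated namespace repeats `MatrixMultiplication`.
set_option linter.dupNamespace false

namespace Summit.MatrixMultiplication.MatrixMultiplication.Theorems

namespace STPPIteratedRoom

open Finset Literature.Computability.AlgebraicComplexity
open scoped Pointwise

variable {G : Type*} [AddCommGroup G] [DecidableEq G]

/-! ## Popular differences compose, and are few -/

/-- Reading of the notation: with `open scoped Pointwise`, `k • D` for a finset `D` is the `k`-fold ITERATED SUMSET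
`D + ⋯ + D` (`k` summands; `0 • D = {0}`), not the dilate `{k • d}`. [bookkeeping] -/
example : (2 • ({0, 1} : Finset ℤ)) = {0, 1, 2} := by decide


/-- The overlap `|W ∩ (W + 0)| = |W|`. [bookkeeping] -/
theorem overlap_zero (W : Finset G) : (W.filter (· - (0 : G) ∈ W)).card = W.card := by
  congr 1
  ext w
  simp

/-- **Popular differences compose.** `|W ∩ (W + d)| + |W ∩ (W + d')| ≤ |W| + |W ∩ (W + (d + d'))|` (both `W ∩ (W + d')` and
`(W ∩ (W + d)) + d'` lie in the `|W|`-set `W + d'`, and their intersection lies in `W ∩ (W + d + d')`). [folklore] -/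
theorem overlap_add (W : Finset G) (d d' : G) :
    (W.filter (· - d ∈ W)).card + (W.filter (· - d' ∈ W)).card ≤
      W.card + (W.filter (· - (d + d') ∈ W)).card := by
  classical
  set X : Finset G := W.filter (· - d' ∈ W) with hX
  set Y : Finset G := (W.filter (· - d ∈ W)).image (· + d') with hY
  set T : Finset G := W.filter (· - (d + d') ∈ W) with hT
  set Wd : Finset G := W.image (· + d') with hWd
  have hYcard : Y.card = (W.filter (· - d ∈ W)).card :=
    card_image_of_injective _ (add_left_injective d')
  have hWdcard : Wd.card = W.card := card_image_of_injective _ (add_left_injective d')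
  have hXsub : X ⊆ Wd := by
    intro w hw
    rw [hX, mem_filter] at hw
    rw [hWd, mem_image]
    exact ⟨w - d', hw.2, by abel⟩
  have hYsub : Y ⊆ Wd := by
    intro w hw
    rw [hY, mem_image] at hw
    obtain ⟨v, hv, rfl⟩ := hw
    rw [mem_filter] at hv
    rw [hWd, mem_image]
    exact ⟨v, hv.1, rfl⟩
  have hXY : X ∩ Y ⊆ T := by
    intro w hw
    rw [mem_inter, hX, mem_filter, hY, mem_image] at hw
    obtain ⟨⟨hwW, -⟩, v, hv, rfl⟩ := hw
    rw [mem_filter] at hv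
    rw [hT, mem_filter]
    refine ⟨hwW, ?_⟩
    have : v + d' - (d + d') = v - d := by abel
    rw [this]
    exact hv.2
  have h1 : (X ∪ Y).card ≤ Wd.card := card_le_card (union_subset hXsub hYsub)
  have h2 : (X ∩ Y).card ≤ T.card := card_le_card hXY
  have h3 := card_union_add_card_inter X Y
  rw [← hYcard, add_comm]
  omega

/-- **Iteration.** If every `d ∈ D` is an `s`-deficient popular difference of `W` (`|W| ≤ |W ∩ (W + d)| + s`), then every element of the
`k`-fold sumset `k • D` is `ks`-deficient: `|W| ≤ |W ∩ (W + d)| + k s`. [original] -/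
theorem overlap_nsmul (W D : Finset G) (s : ℕ) (hD : ∀ d ∈ D, W.card ≤ (W.filter (· - d ∈ W)).card + s) :
    ∀ (k : ℕ), ∀ d ∈ k • D, W.card ≤ (W.filter (· - d ∈ W)).card + k * s := by
  intro k
  induction k with
  | zero =>
    intro d hd
    rw [zero_nsmul, mem_zero] at hd
    subst hd
    rw [overlap_zero]; omega
  | succ k ih =>
    intro d hd
    rw [succ_nsmul, mem_add] at hd
    obtain ⟨x, hx, y, hy, rfl⟩ := hd
    have h1 := ih x hx
    have h2 := hD y hy
    have h3 := overlap_add W x y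
    rw [Nat.succ_mul]
    omega

omit [DecidableEq G] in
/-- **Popular differences are few (double counting).** If every `d ∈ P` satisfies `θ ≤ |W ∩ (W + d)|`, then `|P| · θ ≤ |W|²`
(the pairs `(d, w)` with `d ∈ P`, `w, w − d ∈ W` inject into `W × W` by `(d, w) ↦ (w, w − d)`). [folklore] -/
theorem card_mul_le_card_sq [DecidableEq G] (W P : Finset G) (θ : ℕ) (hP : ∀ d ∈ P, θ ≤ (W.filter (· - d ∈ W)).card) :
    P.card * θ ≤ W.card ^ 2 := by
  classical
  calc P.card * θ = ∑ _d ∈ P, θ := by rw [sum_const, smul_eq_mul]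
    _ ≤ ∑ d ∈ P, (W.filter (· - d ∈ W)).card := sum_le_sum hP
    _ = (P.sigma fun d => W.filter (· - d ∈ W)).card := (card_sigma _ _).symm
    _ ≤ (W ×ˢ W).card := by
        refine card_le_card_of_injOn (fun x => (x.2, x.2 - x.1)) ?_ ?_
        · intro x hx
          rw [mem_coe, mem_sigma, mem_filter] at hx
          rw [mem_coe, mem_product]
          exact ⟨hx.2.1, hx.2.2⟩
        · intro x hx y hy hxy
          simp only [Prod.mk.injEq] at hxy
          obtain ⟨h1, h2⟩ := hxy
          have h3 : x.1 = y.1 := by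
            have := congrArg (fun z => x.2 - z) h2
            simp only [sub_sub_cancel] at this
            rw [this, h1, sub_sub_cancel]
          exact Sigma.ext h3 (heq_of_eq h1)
    _ = W.card ^ 2 := by rw [card_product, sq]

/-- Combining: if every `d ∈ D` is `s`-deficient for `W` (`|W| = V`), then `|k • D| · (V − k s) ≤ V²`. [original] -/
theorem card_nsmul_mul_le (W D : Finset G) (s : ℕ) (hD : ∀ d ∈ D, W.card ≤ (W.filter (· - d ∈ W)).card + s) (k : ℕ) :
    (k • D).card * (W.card - k * s) ≤ W.card ^ 2 :=
  card_mul_le_card_sq W (k • D) _ fun d hd => by have := overlap_nsmul W D s hD k d hd; omega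

/-! ## The STPP application -/

variable [Fintype G] {N : ℕ} {A B C : Fin N → Finset G}

omit [Fintype G] in
/-- `|A_t − B_t + C_t| = |A_t||B_t||C_t|` for a member of an `IsSTPP` family (the TPP of triple `t`, sign pattern `+ − +`).
[cite: CohnKleinbergSzegedyUmans2005, Def. 5.1] -/
theorem card_sub_add_eq (h : IsSTPP A B C) (t : Fin N) :
    (A t - B t + C t).card = (A t).card * (B t).card * (C t).card := by
  classical
  have e : A t - B t + C t = ((A t ×ˢ B t) ×ˢ C t).image fun x => x.1.1 - x.1.2 + x.2 := by
    ext z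
    simp only [mem_add, mem_sub, mem_image, mem_product, Prod.exists]
    constructor
    · rintro ⟨x, ⟨a, ha, b, hb, rfl⟩, c, hc, rfl⟩
      exact ⟨a, b, c, ⟨⟨ha, hb⟩, hc⟩, rfl⟩
    · rintro ⟨a, b, c, ⟨⟨ha, hb⟩, hc⟩, rfl⟩
      exact ⟨a - b, ⟨a, ha, b, hb, rfl⟩, c, hc, rfl⟩
  rw [e, card_image_of_injOn, card_product, card_product]
  rintro ⟨⟨a, b⟩, c⟩ hx ⟨⟨a', b'⟩, c'⟩ hy (hxy : a - b + c = a' - b' + c')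
  simp only [coe_product, Set.mem_prod, mem_coe] at hx hy
  have key : (a - a') + (b' - b) + (c - c') = 0 := by
    have : a = a' - b' + c' + b - c := by rw [← hxy]; abel
    rw [this]; abel
  obtain ⟨-, -, hs, ht, hu⟩ := h t t t a' hy.1.1 a hx.1.1 b hx.1.2 b' hy.1.2 c' hy.2 c hx.2 key
  rw [hs, ht, hu]

/-- **The room lemma, popular-difference form** (mm-stpp-eng-1, QI-FOURIER-NOTE §1 (i), kernel-checked here).  For an `IsSTPP` family
with all `C_u` non-empty, a member `t` with `V = |A_t||B_t||C_t|`, and any `s` with `|G| ≤ V + Σ_{u≠t}|A_u||B_u| + s`: every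
`d ∈ C_t − C_t` satisfies `V ≤ |W ∩ (W + d)| + s` for `W = A_t − B_t + C_t`. [original] -/
theorem room_popular (h : IsSTPP A B C) (hC : ∀ u, (C u).Nonempty) (t : Fin N) (s : ℕ)
    (hs : Fintype.card G ≤ (A t).card * (B t).card * (C t).card +
      (∑ u ∈ univ.erase t, (A u).card * (B u).card) + s) :
    ∀ d ∈ C t - C t, (A t - B t + C t).card ≤
      ((A t - B t + C t).filter (· - d ∈ A t - B t + C t)).card + s := by
  classical
  intro d hd
  set W := A t - B t + C t with hW
  have hV : W.card = (A t).card * (B t).card * (C t).card := card_sub_add_eq h t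
  -- U14⁺: the room
  have hroom := STPPPackingSumset.sum_card_mul_add_card_sumset_le h hC t
  -- `W − C_t = (A_t − B_t) + (C_t − C_t)`
  have hWC : W - C t = (A t - B t) + (C t - C t) := by
    rw [hW, sub_eq_add_neg (A t - B t + C t), add_assoc, ← sub_eq_add_neg (C t)]
  rw [mem_sub] at hd
  obtain ⟨c, hc, c', hc', rfl⟩ := hd
  -- the two translates `W − c'` and `W − c` inside `W − C_t`
  set X : Finset G := W.image (· - c') with hX
  set Y : Finset G := W.image (· - c) with hY
  have hXc : X.card = W.card := card_image_of_injective _ (sub_left_injective)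
  have hYc : Y.card = W.card := card_image_of_injective _ (sub_left_injective)
  have hXs : X ⊆ W - C t := by
    intro x hx; rw [hX, mem_image] at hx; obtain ⟨w, hw, rfl⟩ := hx; exact sub_mem_sub hw hc'
  have hYs : Y ⊆ W - C t := by
    intro x hx; rw [hY, mem_image] at hx; obtain ⟨w, hw, rfl⟩ := hx; exact sub_mem_sub hw hc
  -- their intersection injects into `W ∩ (W + (c − c'))` by `x ↦ x + c`... precisely: `x = w − c' = w' − c`, so `w' = x + c ∈ W`
  -- and `w' − (c − c') = x + c' = w ∈ W`.
  have hXY : (X ∩ Y).card ≤ (W.filter (· - (c - c') ∈ W)).card := by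
    refine card_le_card_of_injOn (· + c) ?_ (fun x _ y _ hxy => by simpa using hxy)
    intro x hx
    rw [mem_coe, mem_inter, hX, hY, mem_image, mem_image] at hx
    obtain ⟨⟨w, hw, rfl⟩, w', hw', he⟩ := hx
    rw [mem_coe, mem_filter]
    refine ⟨?_, ?_⟩
    · show w - c' + c ∈ W
      have : w - c' + c = w' := by rw [← he]; abel
      rw [this]; exact hw'
    · show w - c' + c - (c - c') ∈ W
      have : w - c' + c - (c - c') = w := by abel
      rw [this]; exact hw
  have h1 : (X ∪ Y).card ≤ (W - C t).card := card_le_card (union_subset hXs hYs)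
  have h2 := card_union_add_card_inter X Y
  rw [hWC] at h1
  omega

/-- **Iterated room lemma (C-form).**  For an `IsSTPP` family with all `C_u` non-empty in a finite abelian group `G`, a member `t`
with `V = |A_t||B_t||C_t|`, and any `s` with `|G| ≤ V + Σ_{u≠t}|A_u||B_u| + s` (U14 slack at most `s`): for every `k`,
`|k • (C_t − C_t)| · (V − k s) ≤ V²` — the `k`-fold iterated difference set of the block `C_t` has at most `V²/(V − ks)` elements.
[original] -/
theorem card_nsmul_sub_sub_mul_le (h : IsSTPP A B C) (hC : ∀ u, (C u).Nonempty) (t : Fin N) (s k : ℕ)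
    (hs : Fintype.card G ≤ (A t).card * (B t).card * (C t).card +
      (∑ u ∈ univ.erase t, (A u).card * (B u).card) + s) :
    (k • (C t - C t)).card * ((A t).card * (B t).card * (C t).card - k * s) ≤
      ((A t).card * (B t).card * (C t).card) ^ 2 := by
  rw [← card_sub_add_eq h t]
  exact card_nsmul_mul_le _ _ s (room_popular h hC t s hs) k

/-- **Iterated room lemma, A-form** (rotation `(A,B,C) ↦ (B,C,A)`): with all `A_u` non-empty and
`|G| ≤ V + Σ_{u≠t}|B_u||C_u| + s`, `|k • (A_t − A_t)| · (V − k s) ≤ V²`. [original] -/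
theorem card_nsmul_sub_sub_mul_le_A (h : IsSTPP A B C) (hA : ∀ u, (A u).Nonempty) (t : Fin N) (s k : ℕ)
    (hs : Fintype.card G ≤ (A t).card * (B t).card * (C t).card +
      (∑ u ∈ univ.erase t, (B u).card * (C u).card) + s) :
    (k • (A t - A t)).card * ((A t).card * (B t).card * (C t).card - k * s) ≤
      ((A t).card * (B t).card * (C t).card) ^ 2 := by
  have e : (B t).card * (C t).card * (A t).card = (A t).card * (B t).card * (C t).card := by ring
  have := card_nsmul_sub_sub_mul_le h.rotate hA t s k (by rw [e]; exact hs)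
  rwa [e] at this

/-- **Iterated room lemma, B-form** (rotation `(A,B,C) ↦ (C,A,B)`): with all `B_u` non-empty and
`|G| ≤ V + Σ_{u≠t}|C_u||A_u| + s`, `|k • (B_t − B_t)| · (V − k s) ≤ V²`. [original] -/
theorem card_nsmul_sub_sub_mul_le_B (h : IsSTPP A B C) (hB : ∀ u, (B u).Nonempty) (t : Fin N) (s k : ℕ)
    (hs : Fintype.card G ≤ (A t).card * (B t).card * (C t).card +
      (∑ u ∈ univ.erase t, (C u).card * (A u).card) + s) :
    (k • (B t - B t)).card * ((A t).card * (B t).card * (C t).card - k * s) ≤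
      ((A t).card * (B t).card * (C t).card) ^ 2 := by
  have e : (C t).card * (A t).card * (B t).card = (A t).card * (B t).card * (C t).card := by ring
  have := card_nsmul_sub_sub_mul_le h.rotate.rotate hB t s k (by rw [e]; exact hs)
  rwa [e] at this

end STPPIteratedRoom

end Summit.MatrixMultiplication.MatrixMultiplication.Theorems
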